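import Mathlib
import Summits.Ventures.FusionMHD.Models.TearingFRS1Patch
import Literature.Analysis.ODE.LinearSecondOrder
import HarnessLib

/-!
# F3.r3 instance «TearingFRS1», steps (5)–(7): matching an outer solution to the Frobenius patch gives `Δ′`

Companion of `TearingFRS1.lean` / `TearingFRS1Patch.lean` (instance card `models/F3-SCOPING.md` §7, LADDER-GRIDFUSION
rung F3.r3, model row 6). MODEL M: the scaled marginal tearing equation `IsScaledOuterSolution` of the printed peaked
profile (`q = 1.4(1 + r²)`, mode `(2,1)`, zero β). This file is the ANALYTIC HALF of the `Δ′` certificate and contains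
no large numbers: it turns two OUTER solutions — `L` on `(1 − δ, 1)` (the axis side) and `R` on `(1, 1 + δ)` (the wall
side) — plus their MATCHING DATA against the local Frobenius pair `(ψ_s, ψ_L)` at the two points `u = 1 ∓ x₀` into the
printed tearing index:

* `outer_shift` — an outer solution read in the local variable `x = u − 1` solves the linear equation
  `y″ = 𝔭(x) y′ + 𝔮(x) y` with `𝔭 = −1/(1+x)`, `𝔮 = 4/(1+x)² + 560/((7+3(1+x)²)²((1+x)²−1))` (`modelP`, `modelQ`);
* `patch_combination` — so does every combination `ψ_L + b ψ_s` of the patch pair, on `0 < |x| < δ`, whenever the patch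
  facts (the conclusions of `smallSol_on_patch` / `logSol_on_patch`, taken here as HYPOTHESES on a radius `δ ≤ 1/2` so
  that the file serves the `1/512` patch of `TearingFRS1Patch.lean` and any sharper one alike) hold;
* `repr_of_match` — UNIQUENESS (tree: `Literature.Analysis.ODE.eqOn_of_solution_Ioo`, Grönwall): an outer solution that
  agrees with `ψ_L + b ψ_s` at ONE point of a punctured half-patch agrees with it on the whole half-patch;
* **`isDeltaPrime_of_matching`** — THE MATCHING THEOREM: if `L(1 − x₀) = ψ_L(−x₀) + b_L ψ_s(−x₀)` (with derivatives) and
  `R(1 + x₀) = ψ_L(x₀) + b_R ψ_s(x₀)` (with derivatives), then the glued function `ψ = L ∪ {ψ(1) = 1} ∪ R` has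
  `Tearing.IsDeltaPrime ψ ψ′ 1 (b_R − b_L)` in the printed sense [Miyamoto2007 §9.1 (9.16); Schnack2009 (34.13)] — by
  `Tearing.isDeltaPrime_of_logBranch` with `A = 1`, `κ = 14/5`, `ψ_s′(0) = 1`, `η(0) = 1`.

The numbers `b_L`, `b_R` are Cramer quotients of Wronskians at the matching points (scale-free in `L`, `R`); enclosing
them is the business of the outer-solve files. CERTIFIED here: the implication only. VALIDATED (float preview, seat):
`b_L ≈ −2.13916`, `b_R ≈ +2.98706`, `r_s Δ′ ≈ 5.12622`. MODELLED: model M as in `TearingFRS1.lean` (MV-7R). [instance data]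
-/

noncomputable section

open Set Filter Literature.Analysis.ODE Literature.MathematicalPhysics.MHD
open scoped Topology

namespace Summit.Ventures.FusionMHD.Models

namespace TearingFRS1

/-! ### The model coefficients in the local variable `x = u − 1` -/

/-- `𝔭(x) = −1/(1 + x)`: the coefficient of `y′` in the outer equation `y″ = 𝔭 y′ + 𝔮 y` at `u = 1 + x`. [instance data] -/
def modelP (x : ℝ) : ℝ := -1 / (1 + x)

/-- `𝔮(x) = 4/(1+x)² + 560/((7 + 3(1+x)²)² ((1+x)² − 1))`: the coefficient of `y` in the outer equation at `u = 1 + x`.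
[instance data] -/
def modelQ (x : ℝ) : ℝ := 4 / (1 + x) ^ 2 + 560 / ((7 + 3 * (1 + x) ^ 2) ^ 2 * ((1 + x) ^ 2 - 1))

/-- On `0 < |x| < 1/2` … more generally for `x ≠ 0`, `−1 < x < 1`: the denominators of `𝔭`, `𝔮` do not vanish.
[instance data] -/
theorem model_denoms_ne_zero {x : ℝ} (hx0 : x ≠ 0) (hx1 : -1 < x) (_hx2 : x < 1) :
    (1 + x ≠ 0) ∧ (x + 2 ≠ 0) ∧ (7 + 3 * (1 + x) ^ 2 ≠ 0) ∧ ((1 + x) ^ 2 - 1 ≠ 0) := by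
  refine ⟨by linarith, by linarith, by positivity, ?_⟩
  have : (1 + x) ^ 2 - 1 = x * (x + 2) := by ring
  rw [this]
  exact mul_ne_zero hx0 (by linarith)

/-- `𝔭` is continuous on every set avoiding `x = −1`. [instance data] -/
theorem continuousOn_modelP {s : Set ℝ} (hs : ∀ x ∈ s, 1 + x ≠ 0) : ContinuousOn modelP s := by
  refine ContinuousOn.div continuousOn_const (by fun_prop) hs

/-- `𝔮` is continuous on every set avoiding `x ∈ {0, −1, −2}`. [instance data] -/
theorem continuousOn_modelQ {s : Set ℝ} (hs : ∀ x ∈ s, x ≠ 0 ∧ -1 < x ∧ x < 1) : ContinuousOn modelQ s := by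
  refine ContinuousOn.add ?_ ?_
  · refine ContinuousOn.div continuousOn_const (by fun_prop) fun x hx => ?_
    exact pow_ne_zero 2 (model_denoms_ne_zero (hs x hx).1 (hs x hx).2.1 (hs x hx).2.2).1
  · refine ContinuousOn.div continuousOn_const (by fun_prop) fun x hx => ?_
    obtain ⟨-, -, h7, hu⟩ := model_denoms_ne_zero (hs x hx).1 (hs x hx).2.1 (hs x hx).2.2
    exact mul_ne_zero (pow_ne_zero 2 h7) hu

/-- The local normal form solved for the second derivative: for `x ∉ {0, −1, −2}`,
`x D + p(x) y′ + q(x) y = 0 ↔ D = 𝔭(x) y′ + 𝔮(x) y`. [instance data] -/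
theorem normal_form_iff_model {x y₀ y₁ D : ℝ} (hx0 : x ≠ 0) (hx1 : 1 + x ≠ 0) (hx2 : x + 2 ≠ 0) :
    x * D + p x * y₁ + q x * y₀ = 0 ↔ D = modelP x * y₁ + modelQ x * y₀ := by
  rw [local_normal_form hx0 hx1 hx2, modelP, modelQ]
  constructor <;> intro h <;> rw [h] <;> ring

/-! ### Outer solutions in the local variable -/

/-- An outer solution of MODEL M on a set `s` of radii, read in `x = u − 1`, solves `y″ = 𝔭 y′ + 𝔮 y` on the shifted
set. [instance data] -/
theorem outer_shift {L L' : ℝ → ℝ} {s : Set ℝ} (hL : IsScaledOuterSolution L L' s) {x : ℝ} (hx : 1 + x ∈ s) :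
    HasDerivAt (fun z => L (1 + z)) (L' (1 + x)) x ∧
      HasDerivAt (fun z => L' (1 + z)) (modelP x * L' (1 + x) + modelQ x * L (1 + x)) x := by
  obtain ⟨h1, h2⟩ := hL (1 + x) hx
  refine ⟨h1.comp_const_add 1 x, ?_⟩
  refine (h2.comp_const_add 1 x).congr_deriv ?_
  rw [modelP, modelQ]
  ring

/-! ### The patch pair solves the same linear equation -/

section Patch

-- Names used in the docstrings: the small pair `S = (ψ_s, ψ_s′) = scalarSmallSol pc qc`, the large pair
-- `Lg = (ψ_L, ψ_L′) = scalarLogSol pc qc 1 (14/5) Real.log`, the regular part `E = (η, ζ) = scalarLogRegSol pc qc 1 (14/5)`.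

/-- The PATCH FACTS on a radius `δ`, as delivered by `smallSol_on_patch` (small solution): a HYPOTHESIS BUNDLE (predicate in
`δ`) of this instance, not a cited statement. [instance data] -/
def SmallPatchOn (δ : ℝ) : Prop :=
  ∀ x : ℝ, |x| < δ →
    DifferentiableAt ℝ (scalarSmallSol pc qc) x ∧
      (x ≠ 0 → HasDerivAt (fun z => ((scalarSmallSol pc qc) z).1) (((scalarSmallSol pc qc) x).2) x) ∧
      HasDerivAt (fun z => ((scalarSmallSol pc qc) z).2) ((deriv (scalarSmallSol pc qc) x).2) x ∧
      x * (deriv (scalarSmallSol pc qc) x).2 + p x * ((scalarSmallSol pc qc) x).2 + q x * ((scalarSmallSol pc qc) x).1 = 0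

/-- The PATCH FACTS on a radius `δ`, as delivered by `logSol_on_patch` (large, logarithmic solution): a HYPOTHESIS BUNDLE
(predicate in `δ`) of this instance, not a cited statement. [instance data] -/
def LogPatchOn (δ : ℝ) : Prop :=
  ∀ x : ℝ, |x| < δ → x ≠ 0 →
    HasDerivAt (fun z => ((scalarLogSol pc qc 1 (14 / 5) Real.log) z).1) (((scalarLogSol pc qc 1 (14 / 5) Real.log) x).2) x ∧
      HasDerivAt (fun z => ((scalarLogSol pc qc 1 (14 / 5) Real.log) z).2) ((deriv (scalarLogSol pc qc 1 (14 / 5) Real.log) x).2) x ∧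
      x * (deriv (scalarLogSol pc qc 1 (14 / 5) Real.log) x).2 + p x * ((scalarLogSol pc qc 1 (14 / 5) Real.log) x).2 + q x * ((scalarLogSol pc qc 1 (14 / 5) Real.log) x).1 = 0

/-- The tree's patch (`TearingFRS1Patch.lean`) supplies the small-solution facts on `|x| < 1/64`. [instance data] -/
theorem smallPatchOn_64 : SmallPatchOn (1 / 64) := fun _ hx => smallSol_on_patch hx

/-- The tree's patch (`TearingFRS1Patch.lean`) supplies the log-solution facts on `0 < |x| < 1/512`. [instance data] -/
theorem logPatchOn_512 : LogPatchOn (1 / 512) := fun _ hx hx0 => logSol_on_patch hx hx0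

/-- Monotonicity of the patch facts in the radius. [instance data] -/
theorem SmallPatchOn.mono {δ δ' : ℝ} (h : SmallPatchOn δ) (hle : δ' ≤ δ) : SmallPatchOn δ' :=
  fun x hx => h x (lt_of_lt_of_le hx hle)

/-- Monotonicity of the patch facts in the radius. [instance data] -/
theorem LogPatchOn.mono {δ δ' : ℝ} (h : LogPatchOn δ) (hle : δ' ≤ δ) : LogPatchOn δ' :=
  fun x hx hx0 => h x (lt_of_lt_of_le hx hle) hx0

variable {δ : ℝ}

/-- Values at the surface: `(ψ_s, ψ_s′)(0) = (0, 1)`. [instance data] -/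
theorem small_zero : (scalarSmallSol pc qc) 0 = ((0 : ℝ), (1 : ℝ)) := isScalarLogData.smallSol.1

/-- Values at the surface: `(η, ζ)(0) = (1, 14/5)`. [instance data] -/
theorem reg_zero : (scalarLogRegSol pc qc 1 (14 / 5)) 0 = ((1 : ℝ), (14 / 5 : ℝ)) := (isScalarLogData.logRegSol 1 (14 / 5)).1

/-- `ψ_L = (14/5) log|x| ψ_s + η`. [instance data] -/
theorem log_fst (x : ℝ) : ((scalarLogSol pc qc 1 (14 / 5) Real.log) x).1 = 14 / 5 * Real.log |x| * ((scalarSmallSol pc qc) x).1 + ((scalarLogRegSol pc qc 1 (14 / 5)) x).1 := by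
  rw [scalarLogSol_fst, Real.log_abs, qc_val_0]; norm_num

/-- `ψ_L′ = (14/5) log|x| ψ_s′ + ζ`. [instance data] -/
theorem log_snd (x : ℝ) : ((scalarLogSol pc qc 1 (14 / 5) Real.log) x).2 = 14 / 5 * Real.log |x| * ((scalarSmallSol pc qc) x).2 + ((scalarLogRegSol pc qc 1 (14 / 5)) x).2 := by
  rw [scalarLogSol_snd, Real.log_abs, qc_val_0]; norm_num

/-- Every combination `ψ_L + b ψ_s` of the patch pair solves `y″ = 𝔭 y′ + 𝔮 y` at each `x` with `0 < |x| < δ`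
(`δ ≤ 1/2`). [instance data] -/
theorem patch_combination (hδ : δ ≤ 1 / 2) (hS : SmallPatchOn δ) (hLg : LogPatchOn δ) (b : ℝ) {x : ℝ}
    (hx : |x| < δ) (hx0 : x ≠ 0) :
    HasDerivAt (fun z => ((scalarLogSol pc qc 1 (14 / 5) Real.log) z).1 + b * ((scalarSmallSol pc qc) z).1) (((scalarLogSol pc qc 1 (14 / 5) Real.log) x).2 + b * ((scalarSmallSol pc qc) x).2) x ∧
      HasDerivAt (fun z => ((scalarLogSol pc qc 1 (14 / 5) Real.log) z).2 + b * ((scalarSmallSol pc qc) z).2)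
        (modelP x * (((scalarLogSol pc qc 1 (14 / 5) Real.log) x).2 + b * ((scalarSmallSol pc qc) x).2) + modelQ x * (((scalarLogSol pc qc 1 (14 / 5) Real.log) x).1 + b * ((scalarSmallSol pc qc) x).1)) x := by
  have hx' : -1 < x ∧ x < 1 := by constructor <;> cases abs_lt.1 hx <;> linarith
  obtain ⟨h1, h2, -, -⟩ := model_denoms_ne_zero hx0 hx'.1 hx'.2
  obtain ⟨-, hs1, hs2, hs3⟩ := hS x hx
  obtain ⟨hl1, hl2, hl3⟩ := hLg x hx hx0
  have es : (deriv (scalarSmallSol pc qc) x).2 = modelP x * ((scalarSmallSol pc qc) x).2 + modelQ x * ((scalarSmallSol pc qc) x).1 :=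
    (normal_form_iff_model hx0 h1 h2).1 hs3
  have el : (deriv (scalarLogSol pc qc 1 (14 / 5) Real.log) x).2 = modelP x * ((scalarLogSol pc qc 1 (14 / 5) Real.log) x).2 + modelQ x * ((scalarLogSol pc qc 1 (14 / 5) Real.log) x).1 :=
    (normal_form_iff_model hx0 h1 h2).1 hl3
  refine ⟨hl1.add ((hs1 hx0).const_mul b), ?_⟩
  refine (hl2.add (hs2.const_mul b)).congr_deriv ?_
  rw [es, el]
  ring

/-- **REPRESENTATION BY UNIQUENESS.** Let `(a, c)` be a punctured half-patch (`Ioo a c ⊆ {0 < |x| < δ}`, `δ ≤ 1/2`) and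
`(F, F′)` a solution of `y″ = 𝔭 y′ + 𝔮 y` on it (e.g. an outer solution read in `x = u − 1`, `outer_shift`). If at ONE
point `t₀ ∈ (a, c)` the data of `F` equal those of `ψ_L + b ψ_s`, then `F = ψ_L + b ψ_s` and `F′ = ψ_L′ + b ψ_s′` on
the whole of `(a, c)` (Grönwall uniqueness, `Literature.Analysis.ODE.eqOn_of_solution_Ioo`). [instance data] -/
theorem repr_of_match (hδ : δ ≤ 1 / 2) (hS : SmallPatchOn δ) (hLg : LogPatchOn δ) {a c t₀ : ℝ}
    (hac : ∀ x ∈ Ioo a c, |x| < δ ∧ x ≠ 0) (ht₀ : t₀ ∈ Ioo a c) {F F' : ℝ → ℝ}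
    (hF : ∀ x ∈ Ioo a c, HasDerivAt F (F' x) x ∧ HasDerivAt F' (modelP x * F' x + modelQ x * F x) x) {b : ℝ}
    (h1 : F t₀ = ((scalarLogSol pc qc 1 (14 / 5) Real.log) t₀).1 + b * ((scalarSmallSol pc qc) t₀).1) (h2 : F' t₀ = ((scalarLogSol pc qc 1 (14 / 5) Real.log) t₀).2 + b * ((scalarSmallSol pc qc) t₀).2) :
    ∀ x ∈ Ioo a c, F x = ((scalarLogSol pc qc 1 (14 / 5) Real.log) x).1 + b * ((scalarSmallSol pc qc) x).1 ∧ F' x = ((scalarLogSol pc qc 1 (14 / 5) Real.log) x).2 + b * ((scalarSmallSol pc qc) x).2 := by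
  have hs' : ∀ x ∈ Ioo a c, x ≠ 0 ∧ -1 < x ∧ x < 1 := fun x hx => by
    obtain ⟨h, h0⟩ := hac x hx
    exact ⟨h0, by cases abs_lt.1 h; linarith, by cases abs_lt.1 h; linarith⟩
  have hP : ContinuousOn modelP (Ioo a c) := continuousOn_modelP fun x hx => by linarith [(hs' x hx).2.1]
  have hQ : ContinuousOn modelQ (Ioo a c) := continuousOn_modelQ hs'
  have hG : ∀ x ∈ Ioo a c, HasDerivAt (fun z => ((scalarLogSol pc qc 1 (14 / 5) Real.log) z).1 + b * ((scalarSmallSol pc qc) z).1) (((scalarLogSol pc qc 1 (14 / 5) Real.log) x).2 + b * ((scalarSmallSol pc qc) x).2) x ∧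
      HasDerivAt (fun z => ((scalarLogSol pc qc 1 (14 / 5) Real.log) z).2 + b * ((scalarSmallSol pc qc) z).2)
        (modelP x * (((scalarLogSol pc qc 1 (14 / 5) Real.log) x).2 + b * ((scalarSmallSol pc qc) x).2) + modelQ x * (((scalarLogSol pc qc 1 (14 / 5) Real.log) x).1 + b * ((scalarSmallSol pc qc) x).1)) x :=
    fun x hx => patch_combination hδ hS hLg b (hac x hx).1 (hac x hx).2
  have key := eqOn_of_solution_Ioo (𝕜 := ℝ) hP hQ ht₀ hF hG h1 h2
  exact fun x hx => ⟨key.1 hx, key.2 hx⟩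

/-! ### The matching theorem -/

/-- **MATCHING GIVES `Δ′` (steps (5)–(7) of the F3.r3 pipeline).** Let `0 < x₀ < δ ≤ 1/2` and let the patch facts hold
on radius `δ`. Let `L` be an outer solution of MODEL M on `(1 − δ, 1)` and `R` one on `(1, 1 + δ)`, NORMALISED so that
at the matching points their data are `ψ_L + b_L ψ_s` at `x = −x₀` resp. `ψ_L + b_R ψ_s` at `x = +x₀` (unit coefficient
of the large solution — always reachable by scaling when the Wronskian of the outer solution with `ψ_s` is non-zero).
Let `ψ` be `L` on `(1 − δ, 1)`, `R` on `(1, 1 + δ)`, `ψ(1) = 1` (`= η(0)`), and `ψ′` be `L′`/`R′` accordingly. Then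
`ψ` is continuous at the rational surface and the printed tearing index exists and equals `b_R − b_L`:
`Tearing.IsDeltaPrime ψ ψ′ 1 (b_R − b_L)` [Miyamoto2007 §9.1 (9.16)–(9.17); Schnack2009 (34.13)]. The dimensionless
`r_s Δ′_{2,1}` of MODEL M is this number when `L` is the axis-regular solution and `R` the wall solution. [instance data] -/
theorem isDeltaPrime_of_matching {x₀ : ℝ} (hδ : δ ≤ 1 / 2) (hx₀ : 0 < x₀) (hx₀δ : x₀ < δ) (hS : SmallPatchOn δ)
    (hLg : LogPatchOn δ) {L L' R R' ψ ψ' : ℝ → ℝ} {bL bR : ℝ}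
    (hL : IsScaledOuterSolution L L' (Ioo (1 - δ) 1)) (hR : IsScaledOuterSolution R R' (Ioo 1 (1 + δ)))
    (hLm : L (1 - x₀) = ((scalarLogSol pc qc 1 (14 / 5) Real.log) (-x₀)).1 + bL * ((scalarSmallSol pc qc) (-x₀)).1)
    (hLm' : L' (1 - x₀) = ((scalarLogSol pc qc 1 (14 / 5) Real.log) (-x₀)).2 + bL * ((scalarSmallSol pc qc) (-x₀)).2)
    (hRm : R (1 + x₀) = ((scalarLogSol pc qc 1 (14 / 5) Real.log) x₀).1 + bR * ((scalarSmallSol pc qc) x₀).1) (hRm' : R' (1 + x₀) = ((scalarLogSol pc qc 1 (14 / 5) Real.log) x₀).2 + bR * ((scalarSmallSol pc qc) x₀).2)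
    (hψl : ∀ u ∈ Ioo (1 - δ) 1, ψ u = L u ∧ ψ' u = L' u) (hψ1 : ψ 1 = 1)
    (hψr : ∀ u ∈ Ioo 1 (1 + δ), ψ u = R u ∧ ψ' u = R' u) :
    Tearing.IsDeltaPrime ψ ψ' 1 (bR - bL) := by
  have hδ0 : 0 < δ := hx₀.trans hx₀δ
  -- the representations on the two punctured half-patches
  have hFl : ∀ x ∈ Ioo (-δ) 0, HasDerivAt (fun z => L (1 + z)) (L' (1 + x)) x ∧
      HasDerivAt (fun z => L' (1 + z)) (modelP x * L' (1 + x) + modelQ x * L (1 + x)) x :=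
    fun x hx => outer_shift hL ⟨by linarith [hx.1], by linarith [hx.2]⟩
  have hFr : ∀ x ∈ Ioo 0 δ, HasDerivAt (fun z => R (1 + z)) (R' (1 + x)) x ∧
      HasDerivAt (fun z => R' (1 + z)) (modelP x * R' (1 + x) + modelQ x * R (1 + x)) x :=
    fun x hx => outer_shift hR ⟨by linarith [hx.1], by linarith [hx.2]⟩
  have hacl : ∀ x ∈ Ioo (-δ) 0, |x| < δ ∧ x ≠ 0 := fun x hx => ⟨abs_lt.2 ⟨hx.1, by linarith [hx.2]⟩, hx.2.ne⟩
  have hacr : ∀ x ∈ Ioo 0 δ, |x| < δ ∧ x ≠ 0 := fun x hx => ⟨abs_lt.2 ⟨by linarith [hx.1], hx.2⟩, hx.1.ne'⟩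
  have reprL := repr_of_match hδ hS hLg hacl (t₀ := -x₀) ⟨by linarith, by linarith⟩ hFl
    (b := bL) (by simpa [sub_eq_add_neg] using hLm) (by simpa [sub_eq_add_neg] using hLm')
  have reprR := repr_of_match hδ hS hLg hacr (t₀ := x₀) ⟨hx₀, hx₀δ⟩ hFr (b := bR) hRm hRm'
  -- regularity of the patch data at the surface
  obtain ⟨hSd, -, -, -⟩ := hS 0 (by simpa using hδ0)
  have hEd : DifferentiableAt ℝ (scalarLogRegSol pc qc 1 (14 / 5)) 0 :=
    ((isScalarLogData.logRegSol 1 (14 / 5)).2 0 (by simpa using isScalarLogData.radius_pos)).1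
  have hs : HasDerivAt (fun x => ((scalarSmallSol pc qc) x).1) ((deriv (scalarSmallSol pc qc) 0).1) 0 :=
    (ContinuousLinearMap.fst ℝ ℝ ℝ).hasFDerivAt.comp_hasDerivAt 0 hSd.hasDerivAt
  have hs' : HasDerivAt (fun x => ((scalarSmallSol pc qc) x).2) ((deriv (scalarSmallSol pc qc) 0).2) 0 :=
    (ContinuousLinearMap.snd ℝ ℝ ℝ).hasFDerivAt.comp_hasDerivAt 0 hSd.hasDerivAt
  have hη : ContinuousAt (fun x => ((scalarLogRegSol pc qc 1 (14 / 5)) x).1) 0 :=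
    ((ContinuousLinearMap.fst ℝ ℝ ℝ).hasFDerivAt.comp_hasDerivAt 0 hEd.hasDerivAt).continuousAt
  have hζ : ContinuousAt (fun x => ((scalarLogRegSol pc qc 1 (14 / 5)) x).2) 0 :=
    ((ContinuousLinearMap.snd ℝ ℝ ℝ).hasFDerivAt.comp_hasDerivAt 0 hEd.hasDerivAt).continuousAt
  have hs0 : ((scalarSmallSol pc qc) 0).1 = 0 := by rw [small_zero]
  have hs'0 : ((scalarSmallSol pc qc) 0).2 = 1 := by rw [small_zero]
  have hη0 : ((scalarLogRegSol pc qc 1 (14 / 5)) 0).1 = 1 := by rw [reg_zero]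
  have hA : (1 : ℝ) * ((scalarLogRegSol pc qc 1 (14 / 5)) 0).1 ≠ 0 := by rw [hη0]; norm_num
  have hψ0 : ψ 1 = 1 * ((scalarLogRegSol pc qc 1 (14 / 5)) 0).1 := by rw [hη0, hψ1]; norm_num
  have key := Tearing.isDeltaPrime_of_logBranch (ψ := ψ) (ψ' := ψ') (rs := 1) (κ := 14 / 5) (A := 1) (Bp := bR)
    (Bm := bL) hδ0 hs0 hs hs' hη hζ hA hψ0 ?_ ?_ ?_ ?_
  · have e : (bR - bL) * ((scalarSmallSol pc qc) 0).2 / (1 * ((scalarLogRegSol pc qc 1 (14 / 5)) 0).1) = bR - bL := by rw [hs'0, hη0]; norm_num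
    rwa [e] at key
  · intro x hx
    have hu : 1 + x ∈ Ioo 1 (1 + δ) := ⟨by linarith [hx.1], by linarith [hx.2]⟩
    rw [(hψr _ hu).1, (reprR x hx).1, log_fst]; ring
  · intro x hx
    have hu : 1 + x ∈ Ioo (1 - δ) 1 := ⟨by linarith [hx.1], by linarith [hx.2]⟩
    rw [(hψl _ hu).1, (reprL x hx).1, log_fst]; ring
  · intro x hx
    have hu : 1 + x ∈ Ioo 1 (1 + δ) := ⟨by linarith [hx.1], by linarith [hx.2]⟩
    rw [(hψr _ hu).2, (reprR x hx).2, log_snd]; ring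
  · intro x hx
    have hu : 1 + x ∈ Ioo (1 - δ) 1 := ⟨by linarith [hx.1], by linarith [hx.2]⟩
    rw [(hψl _ hu).2, (reprL x hx).2, log_snd]; ring

/-- **NORMALISATION BY CRAMER.** If an outer solution has data `(y, y′)` at a matching point where the patch data are
`(ψ_L, ψ_L′) = (l₁, l₂)`, `(ψ_s, ψ_s′) = (s₁, s₂)`, and `W(y, ψ_s) = y s₂ − y′ s₁ ≠ 0`, then with
`a := (y s₂ − y′ s₁)/(l₁ s₂ − l₂ s₁)` and `b := (l₁ y′ − l₂ y)/(y s₂ − y′ s₁)` the rescaled data `(y, y′)/a` equal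
`(l₁, l₂) + b (s₁, s₂)` — the shape consumed by `isDeltaPrime_of_matching`; `b` is SCALE-FREE in `(y, y′)`, and `a ≠ 0`
as soon as the patch Wronskian `l₁ s₂ − l₂ s₁` is non-zero (it equals `1/(1 + x)` by Abel's identity). Pure algebra
(with Lean's `x/0 = 0` the two identities even hold without the Wronskian hypothesis). [folklore] -/
theorem cramer_normalise {y y' l₁ l₂ s₁ s₂ : ℝ} (ha : y * s₂ - y' * s₁ ≠ 0) :
    y / ((y * s₂ - y' * s₁) / (l₁ * s₂ - l₂ * s₁)) = l₁ + (l₁ * y' - l₂ * y) / (y * s₂ - y' * s₁) * s₁ ∧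
      y' / ((y * s₂ - y' * s₁) / (l₁ * s₂ - l₂ * s₁)) = l₂ + (l₁ * y' - l₂ * y) / (y * s₂ - y' * s₁) * s₂ := by
  constructor
  · field_simp
    ring
  · field_simp
    ring

/-- Scaling an outer solution by a constant gives an outer solution (linearity of MODEL M's equation). [instance data] -/
theorem IsScaledOuterSolution.smul {L L' : ℝ → ℝ} {s : Set ℝ} (hL : IsScaledOuterSolution L L' s) (c : ℝ) :
    IsScaledOuterSolution (fun u => c * L u) (fun u => c * L' u) s := by
  intro u hu
  obtain ⟨h1, h2⟩ := hL u hu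
  refine ⟨h1.const_mul c, (h2.const_mul c).congr_deriv ?_⟩
  ring

end Patch

end TearingFRS1

end Summit.Ventures.FusionMHD.Models

end
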